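import Summits.BirchSwinnertonDyer.BirchSwinnertonDyer.Theorems.ManinLocalTwoThreeShimuraClassThreeLift
import Summits.BirchSwinnertonDyer.BirchSwinnertonDyer.Theorems.ManinLocalTwoThreeShimuraClasses
import HarnessLib

/-!
# C3 `ManinPrimeToThreeAtNine` helper (es g45, T-es-103, part 3 of 3: §4–§6 covering class, descent, exact order 3; §1–§3 = `…ShimuraClassThree(Lift)`) — THE `3`-PRIMARY SHIMURA CLASS AT THE ADDITIVE LEVEL `27`:
# `3 ∣ [Λ(f) : Λ₁(f)]` and `¬ ShimuraIndexPrimeTo 3 f` for every non-zero `f ∈ S₂(Γ₀(27))`, FACT-FREE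

HONEST FRAMING. Printed mathematics (Ling–Oesterlé 1991, Thm. 1: the Shimura subgroup `Σ(27)` of `J₀(27)` has order
`3`; Mazur 1977 §II.11; Stevens 1982 Ch. 1), new formal proof. Beyond-print theorem: NO. Nothing about any elliptic
curve is asserted; the Manin conjecture `c = 1`, C2, C3 and BSD stay OPEN. This file is a NEGATIVE DATUM for the C3
domain `27 ∣ N`: the Shimura-index hypothesis `ShimuraIndexPrimeTo 3 D.f` FAILS at `N = 27` for EVERY `X₀(27)`-datum
(so no C3 closer may assume it there), in the currency of the route's own predicate.

THE OBSTACLE AND THE TRICK. The landed factorisation `exists_addMonoidHom_periodHomology_of_maninSystem` (route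
ResidualThetaTransportAtTwo, fact-free) turns a left-`Γ₀(N)`-invariant MANIN SYSTEM `M` on `Γ₀(N)\SL₂(ℤ)` with values
in `R` into an additive map `H₁(X₀(N), ℤ) = periodHomology N →+ R` — but only for `R` WITHOUT `3`-TORSION (its torsion
lemma divides by `3` once). The cubic Shimura character `χ : (ℤ/27)ˣ → (ℤ/9)ˣ → ℤ/3` (`χ = log₂ mod 3`, `chi27`)
lives in `R = ℤ/3`. We therefore LIFT: the `ℤ/3`-valued Shimura Manin system `MS_χ(h) = F_χ(h) − F_χ(hS)` of the
cusp function `F_χ` (`cuspFun`; `colFun (a, c) = ψ(c)` off the fibre `9 ∣ c`, `−χ(a)` on it, `ψ(c) = χ(c)` for units,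
`χ(c/3)` for `3 ∥ c`) admits an INTEGRAL LIFT `M̃ : Γ₀(27)\SL₂(ℤ) → ℤ` (`rowFun`, two explicit tables `liftA`, `liftB`
on `P¹(ℤ/27)` with values in `{−2,…,2}`, found by integer elimination on Manin's `18` two-term and `12` three-term
relations at level `27`) that satisfies the two- and three-term relations OVER `ℤ` (`rowFun_S`, `rowFun_three_term`,
kernel-checked by `decide` on `(ℤ/27)²`) and reduces to `MS_χ` mod `3` (`maninInt_cast`). Apply the landed theorem
with `R = ℤ` (no `3`-torsion; `S`- and `TS`-fixed cosets are handled by `2M̃ = 0 ⇒ M̃ = 0`, `3M̃ = 0 ⇒ M̃ = 0` in `ℤ`),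
compose with `ℤ → ℤ/3`, and identify the chain sums with the telescoping sums of `F_χ`: the result is the cubic
SHIMURA COVERING CLASS `φ : periodHomology 27 →+ ℤ/3`, `φ({∞, k∞}) = χ(d_k)` (`exists_shimuraHom_twentySeven`).
Since `dim S₂(Γ₀(27)) = 1` (`finrank_cuspForm_two_eq_genusX0_twentySeven`, a theorem), `φ` descends to `Λ(f)` for
every `f ≠ 0`, kills `Λ₁(f)`, and is `χ(2) = 1 ≠ 0` on `{∞, γ₂∞}_f`, `γ₂ = (14 1; 27 2)`:
`n·{∞, γ₂∞}_f ∉ Λ₁(f)` for `3 ∤ n` (`zsmul_cuspSymbol_gammaTwo_not_mem_twentySeven`), while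
`3·{∞, γ₂∞}_f = {∞, γ₂³∞}_f ∈ Λ₁(f)` (`three_mul_cuspSymbol_gammaTwo_mem_twentySeven`: `d_{γ₂³} ≡ 8 ≡ −19` and
`19 = d_P` for the PARABOLIC `P = (−17 6; −54 19) ∈ Γ₀(27)` fixing the cusp `1/3`, whose period vanishes by the
landed `periodFunctional_eq_zero_of_conj_upper`). Hence the class of `{∞, γ₂∞}_f` in `Λ(f)/Λ₁(f)` has order EXACTLY
`3`, `Λ(f) ≠ Λ₁(f)`, and `¬ ShimuraIndexPrimeTo 3 f` (`not_shimuraIndexPrimeTo_three_twentySeven`) — E15 row `27a1`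
(index `3`, `snf [3,1]`) as a theorem for all `f ≠ 0`.

References: [LingOesterle1991] Thm. 1 and §1; [Mazur1977] §II.11; [Stevens1982] Ch. 1; [Manin1972] Thm. 1.6,
Thm. 1.9; [CremonaAlgorithms1997] §2.1–2.2.
-/

set_option autoImplicit false

noncomputable section

-- justification: the `Summit.BirchSwinnertonDyer.BirchSwinnertonDyer.…` path repeats a component (route-file convention)
set_option linter.dupNamespace false

open scoped Classical MatrixGroups

open CongruenceSubgroup Matrix.SpecialLinearGroup ModularGroup
open Literature.NumberTheory.EllipticCurves.ModularForms
open Summit.BirchSwinnertonDyer.BirchSwinnertonDyer.Theorems.ThetaLayerLambdaCongruenceAtTwo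
open Summit.BirchSwinnertonDyer.Rank1Residual.ManinAdditive.KatoCurve (ShimuraIndexPrimeTo)

namespace Summit.BirchSwinnertonDyer.BirchSwinnertonDyer.Theorems.ManinLocalTwoThree.ShimuraThree
/-! ## §4. The cubic Shimura covering class `φ : H₁(X₀(27), ℤ) → ℤ/3` -/

/-- **The cubic Shimura covering class at level `27`.** There is an additive map `φ : periodHomology 27 →+ ℤ/3` on
`H₁(X₀(27), ℤ) ⊂ S₂(Γ₀(27))^∨` with `φ({∞, k∞}) = χ(d_k)` for every `k ∈ Γ₀(27)` — the class of the cyclic cubic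
Shimura covering `X_χ → X₀(27)`; it kills the image of `Γ₁(27)`. (Manin's theorem 1.9 via the landed
`exists_addMonoidHom_periodHomology_of_maninSystem` over `R = ℤ` applied to the INTEGRAL LIFT `M̃`, then reduced
mod `3`.) [cite: Manin1972, Thm. 1.9] [cite: LingOesterle1991, Thm. 1] -/
theorem exists_shimuraHom_twentySeven : ∃ φ : periodHomology 27 →+ ZMod 3, ∀ k : Gamma0 27,
    φ ⟨periodFunctional 27 k, periodFunctional_mem_periodHomology 27 k⟩ =
      chi27 ((((k : SL(2, ℤ)) 1 1 : ℤ) : ZMod 27)) := by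
  have h3 : ∀ r : ℤ, r + r + r = 0 → r = 0 := fun r hr ↦ by omega
  have hinv : ∀ (δ : Gamma0 27) (h : SL(2, ℤ)), maninInt ((δ : SL(2, ℤ)) * h) = maninInt h := maninInt_inv
  have hτ0 : ∀ (δ : Gamma0 27) (h : SL(2, ℤ)), (δ : SL(2, ℤ)) * h = h * (S * T⁻¹) → maninInt h = 0 :=
    fun δ h hfix ↦ apply_eq_zero_of_tau_fixed maninInt hinv maninInt_three_term h3 δ h hfix
  set M : Gamma0Coset 27 → ℤ := fun q ↦ maninInt (q.out)⁻¹ with hMdef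
  have hM1 : ∀ q, M (S • q) = -M q := fun q ↦ cosetSystem_S maninInt hinv maninInt_neg maninInt_S q
  have hM2 : ∀ q, M q + M ((T * S) • q) + M ((T * S) • (T * S) • q) = 0 := fun q ↦
    cosetSystem_TS maninInt hinv maninInt_neg maninInt_three_term q
  have hM3 : ∀ q, S • q = q → M q = 0 := fun q hq ↦
    cosetSystem_S_fixed maninInt hinv maninInt_sigma_fixed q hq
  have hM4 : ∀ q, (T * S) • q = q → M q = 0 := fun q hq ↦ cosetSystem_TS_fixed maninInt hinv hτ0 q hq
  obtain ⟨φ, hφ⟩ := exists_addMonoidHom_periodHomology_of_maninSystem M hM1 hM2 hM3 hM4 h3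
  refine ⟨(Int.castAddHom (ZMod 3)).comp φ, fun k ↦ ?_⟩
  obtain ⟨L, hL⟩ := exists_maninChain.{0} (k : SL(2, ℤ))
  rw [AddMonoidHom.comp_apply, hφ k L hL, map_list_sum, List.map_map]
  have e : (L.map (⇑(Int.castAddHom (ZMod 3)) ∘ fun g ↦ M ((g⁻¹ : SL(2, ℤ)) : Gamma0Coset 27))) =
      L.map fun g ↦ cuspFun g - cuspFun (g * S) := by
    refine List.map_congr_left fun g _ ↦ ?_
    show ((maninInt (((g⁻¹ : SL(2, ℤ)) : Gamma0Coset 27).out)⁻¹ : ℤ) : ZMod 3) = _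
    rw [apply_out_inv_mk maninInt hinv, inv_inv, maninInt_cast]
  rw [e, hL cuspFun cuspFun_mul_T cuspFun_neg, cuspFun_one, sub_zero, cuspFun_gamma0]

/-! ## §5. Descent to `Λ(f)`: `3 ∣ [Λ(f) : Λ₁(f)]` for every non-zero `f ∈ S₂(Γ₀(27))` -/


/-- `χ(d_γ₁) = 0` for `γ₁ ∈ Γ₁(27)` (`d ≡ 1`). [folklore] -/
theorem chi27_apply_gamma1 (γ₁ : Gamma1 27) : chi27 ((((γ₁ : SL(2, ℤ)) 1 1 : ℤ) : ZMod 27)) = 0 := by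
  have h11 : ((((γ₁ : SL(2, ℤ)) 1 1 : ℤ) : ZMod 27)) = 1 := ((Gamma1_mem 27 _).mp γ₁.2).2.1
  rw [h11, chi27_one]

/-- `γ₂ = (14 1; 27 2) ∈ Γ₀(27)`, `χ(2) = 1`. [folklore] -/
def gammaTwo27 : Gamma0 27 :=
  ⟨⟨!![14, 1; 27, 2], by rw [Matrix.det_fin_two_of]; norm_num⟩, by
    rw [Gamma0_mem]
    show (((27 : ℤ) : ZMod 27)) = 0
    decide⟩

/-- `dim S₂(Γ₀(27)) = 1`: every form is a multiple of a non-zero one (tree theorem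
`finrank_cuspForm_two_eq_genusX0_twentySeven`). [folklore] -/
theorem span_of_ne_zero_twentySeven (f : CuspForm (Gamma0 27) 2) (hf : f ≠ 0) :
    ∀ w : CuspForm (Gamma0 27) 2, ∃ c : ℂ, c • f = w :=
  (finrank_eq_one_iff_of_nonzero' f hf).mp finrank_cuspForm_two_eq_genusX0_twentySeven.2.1

/-- **`n·{∞, γ₂∞}_f ∉ Λ₁(f)` for `3 ∤ n`**, every non-zero `f ∈ S₂(Γ₀(27))`: the class of `{∞, γ₂∞}_f` in `Λ(f)/Λ₁(f)`
has order divisible by `3`. [cite: LingOesterle1991, Thm. 1] -/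
theorem zsmul_cuspSymbol_gammaTwo_not_mem_twentySeven (f : CuspForm (Gamma0 27) 2) (hf : f ≠ 0) (n : ℤ)
    (hn : ((n : ZMod 3)) ≠ 0) : (n : ℂ) * cuspSymbol f gammaTwo27 ∉ periodLatticeGamma1 f := by
  obtain ⟨φ, hφ⟩ := exists_shimuraHom_twentySeven
  refine _root_.Summit.BirchSwinnertonDyer.BirchSwinnertonDyer.Theorems.ManinLocalTwoThree.ShimuraClass.zsmul_cuspSymbol_not_mem_of_hom φ _ hφ chi27_apply_gamma1 f (span_of_ne_zero_twentySeven f hf) gammaTwo27 n ?_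
  rw [show (((gammaTwo27 : SL(2, ℤ)) 1 1 : ℤ)) = 2 from rfl, show (((2 : ℤ) : ZMod 27)) = 2 from rfl, chi27_two,
    zsmul_eq_mul, mul_one]
  exact hn

/-- **`{∞, γ₂∞}_f ∉ Λ₁(f)`** for every non-zero `f ∈ S₂(Γ₀(27))`. [cite: LingOesterle1991, Thm. 1] -/
theorem cuspSymbol_gammaTwo_not_mem_twentySeven (f : CuspForm (Gamma0 27) 2) (hf : f ≠ 0) :
    cuspSymbol f gammaTwo27 ∉ periodLatticeGamma1 f := by
  have := zsmul_cuspSymbol_gammaTwo_not_mem_twentySeven f hf 1 (by decide)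
  rwa [Int.cast_one, one_mul] at this

/-- **THE SHIMURA INDEX AT THE ADDITIVE LEVEL `27` IS NOT `1`: `Λ(f) ≠ Λ₁(f)`** for every non-zero `f ∈ S₂(Γ₀(27))`.
[cite: LingOesterle1991, Thm. 1] -/
theorem periodLattice_ne_periodLatticeGamma1_twentySeven (f : CuspForm (Gamma0 27) 2) (hf : f ≠ 0) :
    periodLattice f ≠ periodLatticeGamma1 f := fun h ↦
  cuspSymbol_gammaTwo_not_mem_twentySeven f hf (h ▸ cuspSymbol_mem_periodLattice f gammaTwo27)

/-! ## §6. The order is exactly `3`: `3·{∞, γ₂∞}_f ∈ Λ₁(f)` via the parabolic element fixing the cusp `1/3` -/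

/-- The parabolic element `P = (−17 6; −54 19) = k (1 6; 0 1) k⁻¹ ∈ Γ₀(27)`, `k = (1 0; 3 1)`, fixing the cusp `1/3`;
`d_P = 19`. [folklore] -/
def parabolicOneThird : Gamma0 27 :=
  ⟨⟨!![-17, 6; -54, 19], by rw [Matrix.det_fin_two_of]; norm_num⟩, by
    rw [Gamma0_mem]
    show (((-54 : ℤ) : ZMod 27)) = 0
    decide⟩

/-- `k = (1 0; 3 1)` and its inverse `(1 0; −3 1)`. [folklore] -/
def kOneThird : SL(2, ℤ) := ⟨!![1, 0; 3, 1], by rw [Matrix.det_fin_two_of]; norm_num⟩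

/-- [folklore] -/
def kOneThirdInv : SL(2, ℤ) := ⟨!![1, 0; -3, 1], by rw [Matrix.det_fin_two_of]; norm_num⟩

/-- `k · k' = 1`. [folklore] -/
theorem kOneThird_mul_inv : kOneThird * kOneThirdInv = 1 := by
  apply Subtype.ext
  rw [Matrix.SpecialLinearGroup.coe_mul, Matrix.SpecialLinearGroup.coe_one]
  ext i j
  fin_cases i <;> fin_cases j <;> rfl

/-- **The period of the parabolic element vanishes**: `{∞, P∞} = 0` in `S₂(Γ₀(27))^∨` (`P` stabilises the cusp
`k∞ = 1/3`; landed `periodFunctional_eq_zero_of_conj_upper`). [cite: Manin1972, §1.5] -/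
theorem periodFunctional_parabolicOneThird : periodFunctional 27 parabolicOneThird = 0 := by
  refine periodFunctional_eq_zero_of_conj_upper parabolicOneThird kOneThird ?_
  rw [inv_eq_of_mul_eq_one_right kOneThird_mul_inv]
  rfl

/-- **`3·{∞, γ₂∞}_f ∈ Λ₁(f)`**: `3·{∞, γ₂∞} = {∞, γ₂³∞}`, `d_{γ₂³} ≡ 8 ≡ −d_P (mod 27)`, and `{∞, P∞} = 0`.
[cite: LingOesterle1991, §1] -/
theorem three_mul_cuspSymbol_gammaTwo_mem_twentySeven (f : CuspForm (Gamma0 27) 2) :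
    (3 : ℂ) * cuspSymbol f gammaTwo27 ∈ periodLatticeGamma1 f := by
  have hpow : cuspSymbol f (gammaTwo27 ^ 3) = (3 : ℂ) * cuspSymbol f gammaTwo27 := by
    rw [cuspSymbol_pow_eq_natCast_mul f gammaTwo27 3]; push_cast; ring
  have hP : cuspSymbol f parabolicOneThird = 0 := by
    rw [← periodFunctional_apply, periodFunctional_parabolicOneThird, LinearMap.zero_apply]
  have hd : ((((gammaTwo27 ^ 3 : Gamma0 27) : SL(2, ℤ)) 1 1 : ℤ) : ZMod 27) =
      -((((parabolicOneThird : SL(2, ℤ)) 1 1 : ℤ) : ZMod 27)) := by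
    rw [apply_one_one_pow_eq, show (((gammaTwo27 : SL(2, ℤ)) 1 1 : ℤ)) = 2 from rfl,
      show (((parabolicOneThird : SL(2, ℤ)) 1 1 : ℤ)) = 19 from rfl]
    decide
  have := cuspSymbol_sub_mem_periodLatticeGamma1_of_apply_eq_neg f parabolicOneThird (gammaTwo27 ^ 3) hd
  rwa [hP, sub_zero, hpow] at this

/-- **THE CLASS OF `{∞, γ₂∞}_f` IN `Λ(f)/Λ₁(f)` HAS ORDER EXACTLY `3`**: `n·{∞, γ₂∞}_f ∈ Λ₁(f) ↔ 3 ∣ n`, for every non-zero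
`f ∈ S₂(Γ₀(27))` (E15 row `27a1`: index `3`, `snf [3, 1]`). [cite: LingOesterle1991, Thm. 1] -/
theorem zsmul_cuspSymbol_gammaTwo_mem_iff_twentySeven (f : CuspForm (Gamma0 27) 2) (hf : f ≠ 0) (n : ℤ) :
    (n : ℂ) * cuspSymbol f gammaTwo27 ∈ periodLatticeGamma1 f ↔ (3 : ℤ) ∣ n := by
  constructor
  · intro h
    by_contra hnd
    exact zsmul_cuspSymbol_gammaTwo_not_mem_twentySeven f hf n
      (fun h0 ↦ hnd ((ZMod.intCast_zmod_eq_zero_iff_dvd n 3).mp h0)) h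
  · rintro ⟨m, rfl⟩
    rw [Int.cast_mul, show ((3 : ℤ) : ℂ) = 3 by norm_num, mul_comm (3 : ℂ) (m : ℂ), mul_assoc, ← zsmul_eq_mul]
    exact (periodLatticeGamma1 f).zsmul_mem (three_mul_cuspSymbol_gammaTwo_mem_twentySeven f) m

/-- **`¬ ShimuraIndexPrimeTo 3 f` AT LEVEL `27`** for every non-zero `f ∈ S₂(Γ₀(27))`: the route's Shimura-index hypothesis
at the prime `3` fails on all of `X₀(27)` (witness `x = {∞, γ₂∞}_f ∈ Λ(f)`: `3x ∈ Λ₁(f)`, `x ∉ Λ₁(f)`).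
[cite: LingOesterle1991, Thm. 1] -/
theorem not_shimuraIndexPrimeTo_three_twentySeven (f : CuspForm (Gamma0 27) 2) (hf : f ≠ 0) :
    ¬ ShimuraIndexPrimeTo 3 f := fun h ↦
  cuspSymbol_gammaTwo_not_mem_twentySeven f hf
    (h _ (cuspSymbol_mem_periodLattice f gammaTwo27) (by
      rw [show ((3 : ℕ) : ℂ) = 3 by norm_num]
      exact three_mul_cuspSymbol_gammaTwo_mem_twentySeven f))

end Summit.BirchSwinnertonDyer.BirchSwinnertonDyer.Theorems.ManinLocalTwoThree.ShimuraThree
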